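/-
Copyright (c) 2026 the pub-hodgecm-mathlib formalisation cell (harness21).  Prover seat hodgecm-mathlib-B-p04 (g48): LH4-plan (g6) WORD #124 «GO, STAGED», ENGINE′ layer (L2′)
= the EISENSTEIN twin of ★ [T2-c] layer 2 `QuadraticRamifiedOrderMonogenic` (A-p19 p846557); 2026-09-02.
-/
import Literature.NumberTheory.Automorphic.QuadraticEisensteinOrderUnitIndex   -- (L1′) p851849 (this seat): `coord_mul_eisenstein`, `isUnit_add_mul_iff_eisenstein`, `index_range_units_map_prod_mul_eq_eisenstein`; brings ★ p846518 (`coord_unique`)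
import Literature.NumberTheory.Automorphic.QuadraticRamifiedOrderMonogenic       -- ★ p846557 (A-p19): generator-free parts reused BY NAME: `const_mem_range_eval₂`, `gen_mem_range_eval₂`, `exists_addEquiv_pi_three`; brings ★ O1 `VandermondeLatticeIndex`
import HarnessLib

/-!
# The monogenic order `R = 𝒪[x]`, `x = (u, λ)`, in `Λ = 𝒪 × O₁` (`O₁ = j𝒪 ⊕ j𝒪θ`, `θ² = jaθ + jk₀` EISENSTEIN), `λ = jp + jqθ`:
# `[Λ : R] = q^{N+n}` with `N = ord q`, `R` local, `ϖ^{N+n}Λ ⊆ R`, `[Λ^× : R^×] = (q−1)q^{N+n−1}`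

Topic `NumberTheory/Automorphic`; namespace `Literature.NumberTheory.Automorphic`.  THEOREMS ONLY (no definition, no instance, no notation, no named fact, no `sorry`); (D0) currency
`[Field E] [ValuativeRel E]`, `𝒪 = 𝒪[E]` a DVR with finite residue field `𝓀`, `q = Nat.card 𝓀[E]`, `hϖ : IsUniformizingElement ϖ`, and the ABSTRACT ring `O₁ = j𝒪 ⊕ j𝒪θ` of
(L1′) `QuadraticEisensteinOrderUnitIndex` (`hcoord`, **`θ² = jaθ + jk₀`, `a, k₀ ∈ 𝔪`**).  Cell `pub/hodgecm-mathlib` (D-0151), crux H413 = `stmt-HodgeConjecture-24833`; LH4-plan (g6) price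
list, B-p04 (g47) memo `MEMO-M4-wild-parity.v1` (4adf46b3) **§4 (c)-CONSUMER row «`TypeTwoUnitIndexAtPlace` at a wild unit row», level `N′ = N + k − ord_v 2`** (census B-p04 (g48)
959b1194): ENGINE′ = Eisenstein twins (L1′)(L2′)(L3′) + head (H′); THIS FILE = (L2′), the twin of ★ `QuadraticRamifiedOrderMonogenic` with the generator written on GENERAL INTEGRAL
COORDINATES `λ = jp + jqθ` and the quadratic relation `λ² − tλ + D = 0` taken as a BINDER (`hlam2`) — at a wild unit-discriminant row `λ₁ = e₂(t + yα)` has `e₂ = 1∕2 ∉ 𝒪_w`, so the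
tame presentation `λ = j(e₂t) + j(e₂y)θ` of ★ is unavailable; there `p = e₂(t + y)`, `q = e₂yϖ^k` and **`N := ord_w q = N_tame + k − ord_v 2`**.  The ★ file (the case `a = 0`,
`p = e₂t`, `q = e₂y`) is UNTOUCHED; its generator-free lemmas `const_mem_range_eval₂`, `gen_mem_range_eval₂`, `exists_addEquiv_pi_three` are cited BY NAME.
HONEST LABEL: HC_CM is proved only modulo the 7 printed citations (2 remaining named inputs: hLiu418 = stmt-HodgeConjecture-24832, h413 = stmt-HodgeConjecture-24833) until rung 0
closes; commutative algebra, count-neutral (pays no organ, opens no road).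

THE MATHEMATICS.  `x = (u, λ)` is killed by the monic cubic `f = (X − u)(X² − tX + D)`, so `R := 𝒪[x] = 𝒪 + 𝒪x + 𝒪x²`; in the `𝒪`-basis `(1,0), (0,1), (0,θ)` of `Λ` the generators
have coordinate matrix `M = [[1, u, u²], [1, p, tp − D], [0, q, tq]]` (second column of `x²` through `λ² = tλ − D` — NO multiplication table needed) with **`det M = q · (u² − tu + D)`**,
so **`[Λ : R] = q^{N+n}`** (`ord q = N`, `ord χ(u) = n`; ★ O1 `#(𝒪³ ⧸ M𝒪³) = #(𝒪 ⧸ det M)`) and `det M · Λ ⊆ R` (adjugate), i.e. **`ϖ^{N+n} Λ ⊆ R`**.  `Λ` is integral over the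
constants (`(a′, jb + jcθ)` is a root of `(X − a′)(X² − (2b + ca)X + (b² + abc − c²k₀))`), so `R^× = R ∩ Λ^×`; with `u ≡ 1`, `p ≡ 1`, `χ(1) = 1 − t + D ≡ 0`, an element `c₀ + c₁x + c₂x²`
has both first coordinates `≡ c₀ + c₁ + c₂`: **`R` is LOCAL with residue field `𝓀`**.  Hence (L1′) `index_range_units_map_prod_mul_eq_eisenstein` gives **`[Λ^× : R^×] = (q − 1) · q^{N+n−1}`**.

* §1 `lam_sq_eq_eisenstein`, `eval₂_cubic_eq_zero_eisenstein`, `mem_range_eval₂_iff_eisenstein`; §2 `det_coordMatrix_eisenstein`, `addEquiv_mulVec_coordMatrix_eisenstein`,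
  `comap_range_eval₂_eq_eisenstein`, `valuation_det_coordMatrix_eisenstein`, **`index_range_eval₂_eq_pow_eisenstein`**, **`pow_mul_mem_range_eval₂_eisenstein`**;
  §3 `isUnit_iff_isUnit_fst_of_mem_range_eisenstein`, `inv_mem_range_eval₂_eisenstein`, **`isLocalRing_range_eval₂_eisenstein`**, `natCard_residueField_range_eval₂_eisenstein`;
  §4 **`index_units_range_eval₂_eq_eisenstein`**.

## References
* [Neukirch1999] J. Neukirch, *Algebraic Number Theory*, Grundlehren 322 (1999): Ch. I §12 (orders, conductor and unit index); Ch. II §5 (Eisenstein extensions).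
* [SerreLocalFields1979] J.-P. Serre, *Local Fields*, GTM 67 (1979): Ch. I §6 Prop. 17–18 (totally ramified extensions, Eisenstein basis).
* [StacksProject] The Stacks Project, Tag 02QG (length of a cokernel = order of the determinant).
* [Rogawski1990] J. D. Rogawski, *Automorphic Representations of Unitary Groups in Three Variables* (1990): §4.9 Lemma 4.9.3 p. 56 (where the index is consumed).
-/

set_option autoImplicit false

noncomputable section

open scoped ValuativeRel
open Polynomial Matrix ValuativeRel

namespace Literature.NumberTheory.Automorphic

variable {E : Type*} [Field E] [ValuativeRel E] {O₁ : Type*} [CommRing O₁] (j : 𝒪[E] →+* O₁) (θ : O₁) {a k₀ : 𝒪[E]}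
  (u : 𝒪[E]) {t D p q : 𝒪[E]} {lam : O₁}

/-! ## §1 The cubic equation and the three-term normal form -/

/-- `λ² = j(tp − D) + j(tq)θ` from `λ = jp + jqθ` and `λ² − tλ + D = 0` (multiplication-table-free). [cite: SerreLocalFields1979, Ch. I §6] -/
theorem lam_sq_eq_eisenstein (hlam : lam = j p + j q * θ) (hlam2 : lam ^ 2 - j t * lam + j D = 0) :
    lam ^ 2 = j (t * p - D) + j (t * q) * θ := by
  have h : lam ^ 2 = j t * lam - j D := by linear_combination hlam2
  rw [h, hlam]
  simp only [map_sub, map_mul]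
  ring

/-- **`x = (u, λ)` IS KILLED BY THE MONIC CUBIC `f = X³ − (t+u)X² + (D+tu)X − uD = (X − u)(X² − tX + D)`** (componentwise). [cite: Neukirch1999, Ch. I §12] -/
theorem eval₂_cubic_eq_zero_eisenstein (hlam2 : lam ^ 2 - j t * lam + j D = 0) :
    Polynomial.eval₂ (RingHom.prod (RingHom.id 𝒪[E]) j) ((u, lam) : 𝒪[E] × O₁)
      (C 1 * X ^ 3 + C (-(t + u)) * X ^ 2 + C (D + t * u) * X + C (-(u * D))) = 0 := by
  simp only [eval₂_add, eval₂_mul, eval₂_C, eval₂_X_pow, eval₂_X, RingHom.prod_apply, RingHom.id_apply]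
  refine Prod.ext ?_ ?_
  · simp only [Prod.fst_add, Prod.fst_mul, Prod.pow_fst, Prod.fst_zero]; ring
  · simp only [Prod.snd_add, Prod.snd_mul, Prod.pow_snd, Prod.snd_zero, map_one, map_neg, map_add, map_mul, one_mul]
    calc lam ^ 3 + -(j t + j u) * lam ^ 2 + (j D + j t * j u) * lam + -(j u * j D)
        = (lam - j u) * (lam ^ 2 - j t * lam + j D) := by ring
      _ = 0 := by rw [hlam2, mul_zero]

/-- **THREE-TERM NORMAL FORM**: the elements of `R = 𝒪[x]` (the range of `f ↦ f(x)`) are exactly the `(c₀, jc₀) + (c₁, jc₁)x + (c₂, jc₂)x²` (reduce modulo the monic cubic;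
Mathlib `modByMonic`, `eval₂_eq_sum_range'`). [cite: Neukirch1999, Ch. I §12] -/
theorem mem_range_eval₂_iff_eisenstein (hlam2 : lam ^ 2 - j t * lam + j D = 0) (z : 𝒪[E] × O₁) :
    z ∈ (Polynomial.eval₂RingHom (RingHom.prod (RingHom.id 𝒪[E]) j) ((u, lam) : 𝒪[E] × O₁)).range ↔
      ∃ c : Fin 3 → 𝒪[E], z = (c 0, j (c 0)) + (c 1, j (c 1)) * (u, lam) + (c 2, j (c 2)) * (u, lam) ^ 2 := by
  classical
  set φ := Polynomial.eval₂RingHom (RingHom.prod (RingHom.id 𝒪[E]) j) ((u, lam) : 𝒪[E] × O₁) with hφ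
  set f : (𝒪[E])[X] := C 1 * X ^ 3 + C (-(t + u)) * X ^ 2 + C (D + t * u) * X + C (-(u * D)) with hf
  have hflead : f.leadingCoeff = 1 := by rw [hf]; exact leadingCoeff_cubic one_ne_zero
  have hfm : f.Monic := hflead
  have hfdeg : f.natDegree = 3 := by rw [hf]; exact natDegree_cubic one_ne_zero
  have hf0 : φ f = 0 := eval₂_cubic_eq_zero_eisenstein j u hlam2
  have hf1 : f ≠ 1 := by
    intro h
    have : f.natDegree = 0 := by rw [h]; exact natDegree_one
    omega
  have hconst : ∀ c : 𝒪[E], φ (C c) = (c, j c) := fun c => by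
    rw [hφ, coe_eval₂RingHom, eval₂_C, RingHom.prod_apply, RingHom.id_apply]
  have hX : φ X = (u, lam) := by rw [hφ, coe_eval₂RingHom, eval₂_X]
  constructor
  · rintro ⟨g, rfl⟩
    have hg : φ g = φ (g %ₘ f) := by
      conv_lhs => rw [← modByMonic_add_div g f]
      rw [map_add, map_mul, hf0, zero_mul, add_zero]
    have hlt : (g %ₘ f).natDegree < 3 := hfdeg ▸ natDegree_modByMonic_lt g hfm hf1
    refine ⟨fun i => (g %ₘ f).coeff i, ?_⟩
    rw [hg, hφ, coe_eval₂RingHom, eval₂_eq_sum_range' _ hlt, Finset.sum_range_succ, Finset.sum_range_succ, Finset.sum_range_succ,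
      Finset.sum_range_zero, zero_add, pow_zero, mul_one, pow_one]
    rfl
  · rintro ⟨c, rfl⟩
    refine ⟨C (c 0) + C (c 1) * X + C (c 2) * X ^ 2, ?_⟩
    rw [map_add, map_add, map_mul, map_mul, map_pow, hconst, hconst, hconst, hX]

/-! ## §2 The coordinate matrix: `[Λ : R] = q^{N+n}` and `ϖ^{N+n} Λ ⊆ R` -/

/-- **THE DETERMINANT OF THE COORDINATE MATRIX** of `1, x, x²` in the basis `(1,0),(0,1),(0,θ)`: `det [[1,u,u²],[1,p,tp−D],[0,q,tq]] = q · (u² − tu + D)` — valid for ANY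
quadratic `O₁` and any `λ = jp + jqθ` with `λ² = tλ − D`. [cite: StacksProject, Tag 02QG] -/
theorem det_coordMatrix_eisenstein :
    (!![1, u, u * u; 1, p, t * p - D; 0, q, t * q] : Matrix (Fin 3) (Fin 3) 𝒪[E]).det = q * (u * u - t * u + D) := by
  rw [Matrix.det_fin_three]
  simp
  ring

/-- The coordinate matrix maps `c = (c₀,c₁,c₂)` to the coordinates of `(c₀, jc₀) + (c₁, jc₁)x + (c₂, jc₂)x²`. [cite: Neukirch1999, Ch. I §12] -/
theorem addEquiv_mulVec_coordMatrix_eisenstein (hlam : lam = j p + j q * θ) (hlam2 : lam ^ 2 - j t * lam + j D = 0)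
    (Ψ : (Fin 3 → 𝒪[E]) ≃+ 𝒪[E] × O₁) (hΨ : ∀ v, Ψ v = (v 0, j (v 1) + j (v 2) * θ)) (c : Fin 3 → 𝒪[E]) :
    Ψ ((!![1, u, u * u; 1, p, t * p - D; 0, q, t * q] : Matrix (Fin 3) (Fin 3) 𝒪[E]) *ᵥ c) =
      (c 0, j (c 0)) + (c 1, j (c 1)) * (u, lam) + (c 2, j (c 2)) * (u, lam) ^ 2 := by
  have hsq := lam_sq_eq_eisenstein j θ hlam hlam2
  rw [hΨ, Prod.pow_mk, hsq, hlam]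
  refine Prod.ext ?_ ?_
  · simp [Matrix.mulVec, dotProduct, Fin.sum_univ_three]
    ring
  · simp [Matrix.mulVec, dotProduct, Fin.sum_univ_three]
    ring

/-- **`R` IN COORDINATES**: the pull-back of `R = 𝒪[x]` along the basis equivalence is the column lattice of the coordinate matrix. [cite: Neukirch1999, Ch. I §12] -/
theorem comap_range_eval₂_eq_eisenstein (hlam : lam = j p + j q * θ) (hlam2 : lam ^ 2 - j t * lam + j D = 0)
    (Ψ : (Fin 3 → 𝒪[E]) ≃+ 𝒪[E] × O₁) (hΨ : ∀ v, Ψ v = (v 0, j (v 1) + j (v 2) * θ)) :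
    (Polynomial.eval₂RingHom (RingHom.prod (RingHom.id 𝒪[E]) j) ((u, lam) : 𝒪[E] × O₁)).range.toAddSubgroup.comap Ψ.toAddMonoidHom =
      (LinearMap.range (Matrix.toLin' (!![1, u, u * u; 1, p, t * p - D; 0, q, t * q] : Matrix (Fin 3) (Fin 3) 𝒪[E]))).toAddSubgroup := by
  ext v
  simp only [AddSubgroup.mem_comap, Subring.mem_toAddSubgroup, Submodule.mem_toAddSubgroup, LinearMap.mem_range,
    Matrix.toLin'_apply]
  rw [RingHom.mem_range]
  change (∃ g, Polynomial.eval₂RingHom _ _ g = Ψ v) ↔ _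
  have key := mem_range_eval₂_iff_eisenstein j u hlam2 (Ψ v)
  rw [RingHom.mem_range] at key
  rw [key]
  constructor
  · rintro ⟨c, hc⟩
    refine ⟨c, Ψ.injective ?_⟩
    rw [addEquiv_mulVec_coordMatrix_eisenstein j θ u hlam hlam2 Ψ hΨ, ← hc]
  · rintro ⟨c, rfl⟩
    exact ⟨c, addEquiv_mulVec_coordMatrix_eisenstein j θ u hlam hlam2 Ψ hΨ c⟩

variable {ϖ : E} {n N : ℕ}

/-- `v(det M) = v(ϖ)^{N+n}` when `ord q = N` and `ord χ(u) = n`. [cite: StacksProject, Tag 02QG] -/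
theorem valuation_det_coordMatrix_eisenstein
    (hn : valuation E ((u * u - t * u + D : 𝒪[E]) : E) = valuation E ϖ ^ n) (hN : valuation E ((q : 𝒪[E]) : E) = valuation E ϖ ^ N) :
    valuation E (((!![1, u, u * u; 1, p, t * p - D; 0, q, t * q] : Matrix (Fin 3) (Fin 3) 𝒪[E]).det : 𝒪[E]) : E) = valuation E ϖ ^ (N + n) := by
  rw [det_coordMatrix_eisenstein u, MulMemClass.coe_mul, map_mul, hN, hn, pow_add]

/-- **`[Λ : R] = q^{N+n}`** for `R = 𝒪[x] ≤ Λ = 𝒪 × O₁` (`#(𝒪³ ⧸ M𝒪³) = #(𝒪 ⧸ det M)`, ★ O1's PID lemma, and `v(det M) = v(ϖ)^{N+n}`), `N = ord q` the order of the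
`θ`-COORDINATE of `λ`. [cite: StacksProject, Tag 02QG] [cite: Neukirch1999, Ch. I §12] -/
theorem index_range_eval₂_eq_pow_eisenstein [IsDiscreteValuationRing 𝒪[E]]
    (hcoord : ∀ z : O₁, ∃! bc : 𝒪[E] × 𝒪[E], z = j bc.1 + j bc.2 * θ) (hlam : lam = j p + j q * θ) (hlam2 : lam ^ 2 - j t * lam + j D = 0)
    (hϖ : IsUniformizingElement ϖ) (hn : valuation E ((u * u - t * u + D : 𝒪[E]) : E) = valuation E ϖ ^ n) (hN : valuation E ((q : 𝒪[E]) : E) = valuation E ϖ ^ N) :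
    (Polynomial.eval₂RingHom (RingHom.prod (RingHom.id 𝒪[E]) j) ((u, lam) : 𝒪[E] × O₁)).range.toAddSubgroup.index = Nat.card 𝓀[E] ^ (N + n) := by
  classical
  obtain ⟨Ψ, hΨ, -⟩ := exists_addEquiv_pi_three j θ hcoord
  set M : Matrix (Fin 3) (Fin 3) 𝒪[E] := !![1, u, u * u; 1, p, t * p - D; 0, q, t * q] with hM
  have hdetv : valuation E ((M.det : 𝒪[E]) : E) = valuation E ϖ ^ (N + n) := valuation_det_coordMatrix_eisenstein u hn hN
  have hdet0 : M.det ≠ 0 := by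
    intro h0
    have h' := hdetv
    rw [h0, ZeroMemClass.coe_zero, map_zero] at h'
    exact pow_ne_zero _ ((Valuation.ne_zero_iff _).2 hϖ.ne_zero) h'.symm
  rw [← AddSubgroup.index_comap_of_surjective _ (f := Ψ.toAddMonoidHom) Ψ.surjective, comap_range_eval₂_eq_eisenstein j θ u hlam hlam2 Ψ hΨ]
  have h1 : (LinearMap.range (Matrix.toLin' M)).toAddSubgroup.index = Nat.card ((Fin 3 → 𝒪[E]) ⧸ LinearMap.range (Matrix.toLin' M)) := rfl
  rw [h1, natCard_quotient_range_toLin'_eq_natCard_quotient_span_det M hdet0, natCard_quotient_span_singleton_of_valuation_eq hϖ hdetv]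

/-- **THE CONDUCTOR CONTAINS `ϖ^{N+n}`**: `(ϖ^{N+n}, jϖ^{N+n}) · z ∈ R` for every `z ∈ Λ` (`det M · 𝒪³ ⊆ M𝒪³` by the adjugate, and `(det M) = (ϖ^{N+n})`).
[cite: Neukirch1999, Ch. I §12] -/
theorem pow_mul_mem_range_eval₂_eisenstein
    (hcoord : ∀ z : O₁, ∃! bc : 𝒪[E] × 𝒪[E], z = j bc.1 + j bc.2 * θ) (hlam : lam = j p + j q * θ) (hlam2 : lam ^ 2 - j t * lam + j D = 0)
    (hϖ : IsUniformizingElement ϖ) (hn : valuation E ((u * u - t * u + D : 𝒪[E]) : E) = valuation E ϖ ^ n) (hN : valuation E ((q : 𝒪[E]) : E) = valuation E ϖ ^ N)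
    (z : 𝒪[E] × O₁) :
    (((⟨ϖ, hϖ.mem⟩ : 𝒪[E]) ^ (N + n), j ((⟨ϖ, hϖ.mem⟩ : 𝒪[E]) ^ (N + n))) : 𝒪[E] × O₁) * z ∈
      (Polynomial.eval₂RingHom (RingHom.prod (RingHom.id 𝒪[E]) j) ((u, lam) : 𝒪[E] × O₁)).range := by
  classical
  obtain ⟨Ψ, hΨ, hΨsmul⟩ := exists_addEquiv_pi_three j θ hcoord
  set M : Matrix (Fin 3) (Fin 3) 𝒪[E] := !![1, u, u * u; 1, p, t * p - D; 0, q, t * q] with hM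
  set R := (Polynomial.eval₂RingHom (RingHom.prod (RingHom.id 𝒪[E]) j) ((u, lam) : 𝒪[E] × O₁)).range with hR
  have hdetz : ((M.det, j M.det) : 𝒪[E] × O₁) * z ∈ R := by
    obtain ⟨v, rfl⟩ := Ψ.surjective z
    rw [← hΨsmul]
    have hv : M.det • v = M *ᵥ (M.adjugate *ᵥ v) := by
      rw [Matrix.mulVec_mulVec, Matrix.mul_adjugate, Matrix.smul_mulVec, Matrix.one_mulVec]
    have hmem : M.det • v ∈ R.toAddSubgroup.comap Ψ.toAddMonoidHom := by
      rw [comap_range_eval₂_eq_eisenstein j θ u hlam hlam2 Ψ hΨ, Submodule.mem_toAddSubgroup, LinearMap.mem_range]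
      exact ⟨M.adjugate *ᵥ v, by rw [Matrix.toLin'_apply, ← hv]⟩
    exact AddSubgroup.mem_comap.1 hmem
  -- `(ϖ^{N+n}) = (det M)`
  have hdetv : valuation E ((M.det : 𝒪[E]) : E) = valuation E ϖ ^ (N + n) := valuation_det_coordMatrix_eisenstein u hn hN
  have hspan := span_singleton_eq_span_uniformizer_pow_of_valuation_eq hϖ hdetv
  have hmemsp : (⟨ϖ, hϖ.mem⟩ : 𝒪[E]) ^ (N + n) ∈ Ideal.span ({M.det} : Set 𝒪[E]) := by
    rw [hspan]; exact Ideal.mem_span_singleton_self _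
  obtain ⟨c, hc⟩ := Ideal.mem_span_singleton'.1 hmemsp
  have heq : (((⟨ϖ, hϖ.mem⟩ : 𝒪[E]) ^ (N + n), j ((⟨ϖ, hϖ.mem⟩ : 𝒪[E]) ^ (N + n))) : 𝒪[E] × O₁) * z =
      ((c, j c) : 𝒪[E] × O₁) * (((M.det, j M.det) : 𝒪[E] × O₁) * z) := by
    rw [← hc, map_mul]
    refine Prod.ext ?_ ?_
    · simp only [Prod.fst_mul]; ring
    · simp only [Prod.snd_mul]; ring
  rw [heq]
  exact R.mul_mem (const_mem_range_eval₂ j u c) hdetz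

/-! ## §3 `R` is local with residue field `𝓀` -/

/-- **UNITS OF `R` ARE DETECTED ON THE FIRST COORDINATE**: for `z ∈ R = 𝒪[x]`, `z` is a unit of `Λ` iff `z.1` is a unit of `𝒪` (`u ≡ 1`, `p ≡ 1`, `χ(1) = 1 − t + D ≡ 0`, so
both first coordinates of `c₀ + c₁x + c₂x²` are `≡ c₀ + c₁ + c₂`; (L1′) `isUnit_add_mul_iff_eisenstein`). [cite: Neukirch1999, Ch. I §12] [cite: SerreLocalFields1979, Ch. I §6 Prop. 17] -/
theorem isUnit_iff_isUnit_fst_of_mem_range_eisenstein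
    (hθ : θ ^ 2 = j a * θ + j k₀) (ha : a ∈ IsLocalRing.maximalIdeal 𝒪[E]) (hk₀ : k₀ ∈ IsLocalRing.maximalIdeal 𝒪[E])
    (hcoord : ∀ z : O₁, ∃! bc : 𝒪[E] × 𝒪[E], z = j bc.1 + j bc.2 * θ) (hlam : lam = j p + j q * θ) (hlam2 : lam ^ 2 - j t * lam + j D = 0)
    (hu1 : u - 1 ∈ IsLocalRing.maximalIdeal 𝒪[E]) (hp1 : p - 1 ∈ IsLocalRing.maximalIdeal 𝒪[E]) (hχ1 : 1 - t + D ∈ IsLocalRing.maximalIdeal 𝒪[E])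
    {z : 𝒪[E] × O₁} (hz : z ∈ (Polynomial.eval₂RingHom (RingHom.prod (RingHom.id 𝒪[E]) j) ((u, lam) : 𝒪[E] × O₁)).range) :
    IsUnit z ↔ IsUnit z.1 := by
  obtain ⟨c, rfl⟩ := (mem_range_eval₂_iff_eisenstein j u hlam2 z).1 hz
  have hsq := lam_sq_eq_eisenstein j θ hlam hlam2
  set a₀ : 𝒪[E] := c 0 + c 1 * u + c 2 * (u * u) with ha₀
  set b : 𝒪[E] := c 0 + c 1 * p + c 2 * (t * p - D) with hb
  set b' : 𝒪[E] := c 1 * q + c 2 * (t * q) with hb'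
  have hz1 : ((c 0, j (c 0)) + (c 1, j (c 1)) * (u, lam) + (c 2, j (c 2)) * (u, lam) ^ 2 : 𝒪[E] × O₁) = (a₀, j b + j b' * θ) := by
    rw [Prod.pow_mk, hsq, hlam, ha₀, hb, hb']
    refine Prod.ext ?_ ?_
    · simp only [Prod.fst_add, Prod.fst_mul]; ring
    · simp only [Prod.snd_add, Prod.snd_mul, map_add, map_mul, map_sub]; ring
  rw [hz1, Prod.isUnit_iff]
  simp only
  rw [isUnit_add_mul_iff_eisenstein j θ hθ ha hk₀ hcoord]
  -- `a₀ ≡ b (mod 𝔪)`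
  have hab : a₀ - b ∈ IsLocalRing.maximalIdeal 𝒪[E] := by
    have e1 : a₀ - b = c 1 * (u - 1) - c 1 * (p - 1) + c 2 * (u + 1) * (u - 1) - c 2 * t * (p - 1) + c 2 * (1 - t + D) := by
      rw [ha₀, hb]; ring
    rw [e1]
    refine Ideal.add_mem _ (Ideal.sub_mem _ (Ideal.add_mem _ (Ideal.sub_mem _ (Ideal.mul_mem_left _ _ hu1) (Ideal.mul_mem_left _ _ hp1))
      (Ideal.mul_mem_left _ _ hu1)) (Ideal.mul_mem_left _ _ hp1)) (Ideal.mul_mem_left _ _ hχ1)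
  have key : IsUnit a₀ ↔ IsUnit b := by
    constructor
    · intro hua
      by_contra hnb
      have hbm : b ∈ IsLocalRing.maximalIdeal 𝒪[E] := (IsLocalRing.mem_maximalIdeal _).2 hnb
      have : a₀ ∈ IsLocalRing.maximalIdeal 𝒪[E] := by simpa using Ideal.add_mem _ hab hbm
      exact (IsLocalRing.mem_maximalIdeal _ |>.1 this) hua
    · intro hub
      by_contra hna
      have ham : a₀ ∈ IsLocalRing.maximalIdeal 𝒪[E] := (IsLocalRing.mem_maximalIdeal _).2 hna
      have : b ∈ IsLocalRing.maximalIdeal 𝒪[E] := by simpa using Ideal.sub_mem _ ham hab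
      exact (IsLocalRing.mem_maximalIdeal _ |>.1 this) hub
  rw [key, and_self]

/-- **`R` IS INVERSE-CLOSED IN `Λ`** (`Λ` is integral over the constants: `z = (a′, jb + jcθ)` is a root of the monic cubic `(X − a′)(X² − (2b + ca)X + (b² + abc − c²k₀))` — trace and
norm of `jb + jcθ` for `θ² = jaθ + jk₀` — with unit constant term when `z ∈ Λ^×`, so `z⁻¹` is a polynomial in `z` with constant coefficients). [cite: Neukirch1999, Ch. I §12] -/
theorem inv_mem_range_eval₂_eisenstein
    (hθ : θ ^ 2 = j a * θ + j k₀) (ha : a ∈ IsLocalRing.maximalIdeal 𝒪[E]) (hk₀ : k₀ ∈ IsLocalRing.maximalIdeal 𝒪[E])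
    (hcoord : ∀ z : O₁, ∃! bc : 𝒪[E] × 𝒪[E], z = j bc.1 + j bc.2 * θ) {z : 𝒪[E] × O₁} (hzu : IsUnit z)
    (hz : z ∈ (Polynomial.eval₂RingHom (RingHom.prod (RingHom.id 𝒪[E]) j) ((u, lam) : 𝒪[E] × O₁)).range) :
    (↑hzu.unit⁻¹ : 𝒪[E] × O₁) ∈ (Polynomial.eval₂RingHom (RingHom.prod (RingHom.id 𝒪[E]) j) ((u, lam) : 𝒪[E] × O₁)).range := by
  set R := (Polynomial.eval₂RingHom (RingHom.prod (RingHom.id 𝒪[E]) j) ((u, lam) : 𝒪[E] × O₁)).range with hR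
  obtain ⟨⟨b, c⟩, hw, -⟩ := hcoord z.2
  simp only at hw
  have hzu' := Prod.isUnit_iff.1 hzu
  have hua : IsUnit z.1 := hzu'.1
  have hub : IsUnit b := by
    have h := hzu'.2
    rw [hw, isUnit_add_mul_iff_eisenstein j θ hθ ha hk₀ hcoord] at h; exact h
  have hp0u : IsUnit (z.1 * (b * b + a * b * c - c * c * k₀)) := by
    refine hua.mul ?_
    by_contra hn
    have hm : c * c * k₀ ∈ IsLocalRing.maximalIdeal 𝒪[E] := Ideal.mul_mem_left _ _ hk₀
    have hm' : a * b * c ∈ IsLocalRing.maximalIdeal 𝒪[E] := Ideal.mul_mem_right _ _ (Ideal.mul_mem_right _ _ ha)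
    have hn' : b * b + a * b * c - c * c * k₀ ∈ IsLocalRing.maximalIdeal 𝒪[E] := (IsLocalRing.mem_maximalIdeal _).2 hn
    have : b * b ∈ IsLocalRing.maximalIdeal 𝒪[E] := by
      have := Ideal.sub_mem _ (Ideal.add_mem _ hn' hm) hm'
      rwa [sub_add_cancel, add_sub_cancel_right] at this
    rcases (IsLocalRing.maximalIdeal.isMaximal 𝒪[E]).isPrime.mem_or_mem this with h | h <;>
      exact ((IsLocalRing.mem_maximalIdeal _).1 h) hub
  obtain ⟨p₀, hp₀⟩ := hp0u
  -- the cubic relation, written as `z · Q(z) = (p₀, j p₀)` with `Q(z) = z² − (a′ + 2b + ca) z + (a′(2b + ca) + (b² + abc − c²k₀))`, `a′ = z.1`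
  set qz : 𝒪[E] × O₁ := z * z - ((z.1 + (2 * b + c * a), j (z.1 + (2 * b + c * a))) : 𝒪[E] × O₁) * z +
    (z.1 * (2 * b + c * a) + (b * b + a * b * c - c * c * k₀), j (z.1 * (2 * b + c * a) + (b * b + a * b * c - c * c * k₀))) with hqz
  have hrel : z * qz = ((↑p₀, j ↑p₀) : 𝒪[E] × O₁) := by
    rw [hp₀, hqz]
    have hθ2 : θ * θ = j a * θ + j k₀ := by rw [← sq, hθ]
    refine Prod.ext ?_ ?_
    · simp only [Prod.fst_mul, Prod.fst_sub, Prod.fst_add]; ring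
    · simp only [Prod.snd_mul, Prod.snd_sub, Prod.snd_add, map_add, map_mul, map_sub, map_ofNat]
      rw [hw]
      linear_combination (j c * j c) * ((j b + j c * θ) - j z.1) * hθ2
  -- hence `z⁻¹ = Q(z) · (p₀⁻¹, j p₀⁻¹) ∈ R`
  have hqR : qz ∈ R := by
    rw [hqz]
    exact R.add_mem (R.sub_mem (R.mul_mem hz hz) (R.mul_mem (const_mem_range_eval₂ j u _) hz)) (const_mem_range_eval₂ j u _)
  have hone : (hzu.unit : 𝒪[E] × O₁) * (qz * ((↑p₀⁻¹, j ↑p₀⁻¹) : 𝒪[E] × O₁)) = 1 := by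
    rw [IsUnit.unit_spec, ← mul_assoc, hrel, Prod.mk_mul_mk, ← map_mul, Units.mul_inv, map_one]; rfl
  rw [Units.inv_eq_of_mul_eq_one_right hone]
  exact R.mul_mem hqR (const_mem_range_eval₂ j u _)

/-- **`R = 𝒪[x]` IS A LOCAL RING** whose units are detected by the residue of the first coordinate. [cite: Neukirch1999, Ch. I §12] -/
theorem isLocalRing_range_eval₂_eisenstein
    (hθ : θ ^ 2 = j a * θ + j k₀) (ha : a ∈ IsLocalRing.maximalIdeal 𝒪[E]) (hk₀ : k₀ ∈ IsLocalRing.maximalIdeal 𝒪[E])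
    (hcoord : ∀ z : O₁, ∃! bc : 𝒪[E] × 𝒪[E], z = j bc.1 + j bc.2 * θ) (hlam : lam = j p + j q * θ) (hlam2 : lam ^ 2 - j t * lam + j D = 0)
    (hu1 : u - 1 ∈ IsLocalRing.maximalIdeal 𝒪[E]) (hp1 : p - 1 ∈ IsLocalRing.maximalIdeal 𝒪[E]) (hχ1 : 1 - t + D ∈ IsLocalRing.maximalIdeal 𝒪[E]) :
    IsLocalRing (Polynomial.eval₂RingHom (RingHom.prod (RingHom.id 𝒪[E]) j) ((u, lam) : 𝒪[E] × O₁)).range := by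
  set R := (Polynomial.eval₂RingHom (RingHom.prod (RingHom.id 𝒪[E]) j) ((u, lam) : 𝒪[E] × O₁)).range with hR
  have hunit : ∀ r : R, IsUnit r ↔ IsUnit (r : 𝒪[E] × O₁).1 := by
    intro r
    rw [← isUnit_iff_isUnit_fst_of_mem_range_eisenstein j θ u hθ ha hk₀ hcoord hlam hlam2 hu1 hp1 hχ1 r.2]
    constructor
    · intro h; exact h.map R.subtype
    · intro h
      have hinv := inv_mem_range_eval₂_eisenstein j θ u hθ ha hk₀ hcoord h r.2
      refine IsUnit.of_mul_eq_one ⟨_, hinv⟩ (Subtype.ext ?_)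
      change (r : 𝒪[E] × O₁) * ↑h.unit⁻¹ = 1
      exact h.mul_val_inv
  haveI : Nontrivial R := by
    refine ⟨⟨0, 1, fun h => ?_⟩⟩
    have := congrArg (fun r : R => (r : 𝒪[E] × O₁).1) h
    simp at this
  refine IsLocalRing.of_nonunits_add ?_
  intro r s hr hs
  rw [mem_nonunits_iff, hunit] at hr hs ⊢
  rw [Subring.coe_add, Prod.fst_add]
  intro hrs
  have hrm : (r : 𝒪[E] × O₁).1 ∈ IsLocalRing.maximalIdeal 𝒪[E] := (IsLocalRing.mem_maximalIdeal _).2 hr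
  have hsm : (s : 𝒪[E] × O₁).1 ∈ IsLocalRing.maximalIdeal 𝒪[E] := (IsLocalRing.mem_maximalIdeal _).2 hs
  exact (IsLocalRing.mem_maximalIdeal _ |>.1 (Ideal.add_mem _ hrm hsm)) hrs

/-- **THE RESIDUE FIELD OF `R` IS `𝓀`**: `#k_R = q` (the residue of the first coordinate is onto `𝓀` with kernel the non-units). [cite: Neukirch1999, Ch. I §12] -/
theorem natCard_residueField_range_eval₂_eisenstein
    (hθ : θ ^ 2 = j a * θ + j k₀) (ha : a ∈ IsLocalRing.maximalIdeal 𝒪[E]) (hk₀ : k₀ ∈ IsLocalRing.maximalIdeal 𝒪[E])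
    (hcoord : ∀ z : O₁, ∃! bc : 𝒪[E] × 𝒪[E], z = j bc.1 + j bc.2 * θ) (hlam : lam = j p + j q * θ) (hlam2 : lam ^ 2 - j t * lam + j D = 0)
    (hu1 : u - 1 ∈ IsLocalRing.maximalIdeal 𝒪[E]) (hp1 : p - 1 ∈ IsLocalRing.maximalIdeal 𝒪[E]) (hχ1 : 1 - t + D ∈ IsLocalRing.maximalIdeal 𝒪[E]) :
    @Nat.card (@IsLocalRing.ResidueField (Polynomial.eval₂RingHom (RingHom.prod (RingHom.id 𝒪[E]) j) ((u, lam) : 𝒪[E] × O₁)).range _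
      (isLocalRing_range_eval₂_eisenstein j θ u hθ ha hk₀ hcoord hlam hlam2 hu1 hp1 hχ1)) = Nat.card 𝓀[E] := by
  set R := (Polynomial.eval₂RingHom (RingHom.prod (RingHom.id 𝒪[E]) j) ((u, lam) : 𝒪[E] × O₁)).range with hR
  letI := isLocalRing_range_eval₂_eisenstein j θ u hθ ha hk₀ hcoord hlam hlam2 hu1 hp1 hχ1
  set χ : R →+* 𝓀[E] := (IsLocalRing.residue 𝒪[E]).comp ((RingHom.fst 𝒪[E] O₁).comp R.subtype) with hχ
  have hχapp : ∀ r : R, χ r = IsLocalRing.residue 𝒪[E] (r : 𝒪[E] × O₁).1 := fun _ => rfl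
  have hsurj : Function.Surjective χ := by
    intro x
    obtain ⟨c, rfl⟩ := IsLocalRing.residue_surjective x
    exact ⟨⟨(c, j c), const_mem_range_eval₂ j u c⟩, rfl⟩
  have hunit : ∀ r : R, IsUnit r ↔ IsUnit (r : 𝒪[E] × O₁).1 := by
    intro r
    rw [← isUnit_iff_isUnit_fst_of_mem_range_eisenstein j θ u hθ ha hk₀ hcoord hlam hlam2 hu1 hp1 hχ1 r.2]
    constructor
    · intro h; exact h.map R.subtype
    · intro h
      have hinv := inv_mem_range_eval₂_eisenstein j θ u hθ ha hk₀ hcoord h r.2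
      refine IsUnit.of_mul_eq_one ⟨_, hinv⟩ (Subtype.ext ?_)
      change (r : 𝒪[E] × O₁) * ↑h.unit⁻¹ = 1
      exact h.mul_val_inv
  have hker : RingHom.ker χ = IsLocalRing.maximalIdeal R := by
    ext r
    rw [RingHom.mem_ker, hχapp, IsLocalRing.residue_eq_zero_iff, IsLocalRing.mem_maximalIdeal, IsLocalRing.mem_maximalIdeal, mem_nonunits_iff,
      mem_nonunits_iff, hunit]
  unfold IsLocalRing.ResidueField
  rw [← hker]
  exact Nat.card_congr (RingHom.quotientKerEquivOfSurjective hsurj).toEquiv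

/-! ## §4 The unit index -/

/-- **THE UNIT INDEX OF THE MONOGENIC ORDER `𝒪[x] ≤ 𝒪 × 𝒪[θ]`, `θ` EISENSTEIN**: with `[Λ : R] = q^{N+n}` (`N = ord` of the `θ`-coordinate of `λ`, `n = ord χ(u)`), `N + n ≥ 1`:
**`[Λ^× : R^×] = (q − 1) · q^{N+n−1}`** ((L1′) `index_range_units_map_prod_mul_eq_eisenstein` with the conductor `ϖ^{N+n}`, locality and residue field of §3).  At `𝒪 = 𝒪_w` (`q = N(v)²`)
and a WILD unit-discriminant type-(2) row this is `[𝒪_A^× : 𝒪_w[δ]^×]` for the eigen-algebra `A = L_w × K₁` with `N = N_tame + k − ord_v 2` (memo 4adf46b3 §4 (c)-consumer row).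
[cite: Neukirch1999, Ch. I §12] [cite: Rogawski1990, §4.9 Lemma 4.9.3 p. 56] -/
theorem index_units_range_eval₂_eq_eisenstein [IsDiscreteValuationRing 𝒪[E]] [Finite 𝓀[E]]
    (hθ : θ ^ 2 = j a * θ + j k₀) (ha : a ∈ IsLocalRing.maximalIdeal 𝒪[E]) (hk₀ : k₀ ∈ IsLocalRing.maximalIdeal 𝒪[E])
    (hcoord : ∀ z : O₁, ∃! bc : 𝒪[E] × 𝒪[E], z = j bc.1 + j bc.2 * θ) (hlam : lam = j p + j q * θ) (hlam2 : lam ^ 2 - j t * lam + j D = 0)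
    (hu1 : u - 1 ∈ IsLocalRing.maximalIdeal 𝒪[E]) (hp1 : p - 1 ∈ IsLocalRing.maximalIdeal 𝒪[E]) (hχ1 : 1 - t + D ∈ IsLocalRing.maximalIdeal 𝒪[E])
    (hϖ : IsUniformizingElement ϖ) (hn : valuation E ((u * u - t * u + D : 𝒪[E]) : E) = valuation E ϖ ^ n) (hN : valuation E ((q : 𝒪[E]) : E) = valuation E ϖ ^ N)
    (hNn : 1 ≤ N + n) :
    (Units.map ((Polynomial.eval₂RingHom (RingHom.prod (RingHom.id 𝒪[E]) j) ((u, lam) : 𝒪[E] × O₁)).range.subtype :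
        (Polynomial.eval₂RingHom (RingHom.prod (RingHom.id 𝒪[E]) j) ((u, lam) : 𝒪[E] × O₁)).range →* 𝒪[E] × O₁)).range.index =
      (Nat.card 𝓀[E] - 1) * Nat.card 𝓀[E] ^ (N + n - 1) := by
  set R := (Polynomial.eval₂RingHom (RingHom.prod (RingHom.id 𝒪[E]) j) ((u, lam) : 𝒪[E] × O₁)).range with hR
  letI := isLocalRing_range_eval₂_eisenstein j θ u hθ ha hk₀ hcoord hlam hlam2 hu1 hp1 hχ1
  have hq : 1 < Nat.card 𝓀[E] := Finite.one_lt_card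
  have hres := natCard_residueField_range_eval₂_eisenstein j θ u hθ ha hk₀ hcoord hlam hlam2 hu1 hp1 hχ1
  have hcond := pow_mul_mem_range_eval₂_eisenstein j θ u hcoord hlam hlam2 hϖ hn hN
  have hidx := index_range_eval₂_eq_pow_eisenstein j θ u hcoord hlam hlam2 hϖ hn hN
  have key := index_range_units_map_prod_mul_eq_eisenstein j θ hθ ha hk₀ hcoord hϖ hNn R hres hcond
  rw [hidx] at key
  have hpow : Nat.card 𝓀[E] ^ (N + n) = Nat.card 𝓀[E] ^ (N + n - 1) * Nat.card 𝓀[E] := by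
    rw [← pow_succ, Nat.sub_add_cancel hNn]
  rw [hpow, ← mul_assoc] at key
  exact Nat.eq_of_mul_eq_mul_right (by omega) key

end Literature.NumberTheory.Automorphic

end
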